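import Mathlib
import Literature.NumberTheory.LFunctions.SuzukiSingleOperatorKernelProofs
import Summits.RiemannHypothesis.RiemannHypothesis.Theorems.DeBrangesSuzukiDoorKernelSupportSymbolDecayUniform
import Summits.RiemannHypothesis.RiemannHypothesis.Theorems.DeBrangesSuzukiDoorKernelSupportLineIndependence
import Summits.RiemannHypothesis.RiemannHypothesis.Theorems.DeBrangesSuzukiDoorKernelSupportVanishingGeneric
import Summits.RiemannHypothesis.RiemannHypothesis.Theorems.DeBrangesSuzukiDoorLaplaceWindow
import Summits.RiemannHypothesis.RiemannHypothesis.Theorems.SuzukiWeightedDoorLogDeriv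
import Summits.RiemannHypothesis.RiemannHypothesis.Theorems.SuzukiWeightedDoorRung

/-!
# SuzukiWeightedDoor — the converse `WitnessOfZeroFree` (RH-FREE implication), PROVED (module 4/6)

RH-FREE THEOREM `witnessOfZeroFree`: for `θ > 10`, `1/2 ≤ σ₀ < 1/2 + η`: if `ξ ≠ 0` on `Re s > σ₀` then
`e^{−ηx} W_θ(x) ∈ L²(ℝ)`.  C3 of the chain: holomorphy of `Θ_θ` on `Im z > σ₀ − 1/2` from zero-freeness, the uniform
symbol bound on closed sub-strips (C2 + compactness), the contour shift `Im z = 1 → Im z = σ₀ − 1/2 + 4δ` of the inverse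
Fourier–Laplace line integral (`invFL_line_shift`, eng's rectangle argument made parametric), the kernel growth
`|K_θ(x)| ≤ D e^{(σ₀ − 1/2 + 4δ)x}`, and the weighted-window lemma of module 3.  An implication between RH-free
quantities; nothing here bears on the truth of RH.
-/

set_option linter.dupNamespace false

noncomputable section

open Complex Metric Set Filter Topology

namespace Summit.RiemannHypothesis.RiemannHypothesis.Theorems.SuzukiWeightedDoorConverse

open MeasureTheory Literature.NumberTheory.LFunctions
open Summit.RiemannHypothesis.RiemannHypothesis.Cruxes.KernelSupport.Birth
open Summit.RiemannHypothesis.RiemannHypothesis.Theorems.SuzukiWeightedDoorLogDeriv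

/-! ### C3: holomorphy from zero-freeness, uniform bound, line shift, kernel growth -/

/-- RH-FREE implication: if `ξ ≠ 0` on `Re s > σ₀` then `Θ_θ` is holomorphic on `Im z > σ₀ − 1/2`. -/
theorem differentiableOn_thetaSym_of_zeroFree (θ : ℝ) {σ₀ : ℝ}
    (hZ : ∀ s : ℂ, σ₀ < s.re → riemannXi s ≠ 0) :
    DifferentiableOn ℂ (thetaSym θ) {z : ℂ | σ₀ - 1 / 2 < z.im} := by
  have hξa : AnalyticOnNhd ℂ riemannXi Set.univ :=
    differentiable_riemannXi.differentiableOn.analyticOnNhd isOpen_univ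
  have hdξ : Differentiable ℂ (deriv riemannXi) := fun z => (hξa.deriv z (Set.mem_univ z)).differentiableAt
  intro z hz
  have hz' : σ₀ - 1 / 2 < z.im := hz
  have hg : DifferentiableAt ℂ (fun w : ℂ => (1 : ℂ) / 2 - I * w) z := by fun_prop
  have hne : riemannXi ((1 : ℂ) / 2 - I * z) ≠ 0 := hZ _ (by simp; linarith)
  have h1 : DifferentiableAt ℂ (fun w => deriv riemannXi ((1 : ℂ) / 2 - I * w)) z := (hdξ _).comp z hg
  have h2 : DifferentiableAt ℂ (fun w => riemannXi ((1 : ℂ) / 2 - I * w)) z :=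
    (differentiable_riemannXi _).comp z hg
  have h3 : DifferentiableAt ℂ (fun w => Complex.exp (-2 * (θ : ℂ) *
      (deriv riemannXi ((1 : ℂ) / 2 - I * w) / riemannXi ((1 : ℂ) / 2 - I * w)))) z :=
    ((h1.div h2 hne).const_mul _).cexp
  exact h3.differentiableWithinAt

/-- Continuity of `u ↦ Φ(u + iy)` for `y > c₀` when `Φ` is holomorphic on `Im z > c₀`. -/
theorem continuous_line_of_differentiableOn {Φ : ℂ → ℂ} {c₀ y : ℝ}
    (hd : DifferentiableOn ℂ Φ {z : ℂ | c₀ < z.im}) (hy : c₀ < y) :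
    Continuous (fun u : ℝ => Φ ((u : ℂ) + (y : ℂ) * I)) := by
  have hline : Continuous (fun u : ℝ => (u : ℂ) + (y : ℂ) * I) := by fun_prop
  refine continuous_iff_continuousAt.2 fun u => ?_
  have hmem : (u : ℂ) + (y : ℂ) * I ∈ {z : ℂ | c₀ < z.im} := by
    show c₀ < ((u : ℂ) + (y : ℂ) * I).im
    simp; linarith
  have hopen : IsOpen {z : ℂ | c₀ < z.im} := isOpen_lt continuous_const Complex.continuous_im
  have h1 : ContinuousAt Φ ((u : ℂ) + (y : ℂ) * I) :=
    ((hd _ hmem).differentiableAt (hopen.mem_nhds hmem)).continuousAt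
  exact ContinuousAt.comp (g := Φ) (f := fun u : ℝ => (u : ℂ) + (y : ℂ) * I) h1 hline.continuousAt

/-- RH-FREE implication: a UNIFORM bound `‖Θ_θ(u+iy)‖ ≤ C (1+|u|)^{−θ/2}` on the closed strip
`σ₀ − 1/2 + 4δ ≤ y ≤ 1` (C2 for `|u| ≥ 8`, compactness for `|u| ≤ 8`). -/
theorem norm_thetaSym_le_uniform {θ σ₀ δ : ℝ} (hθ : 10 < θ) (hσ₀ : 1 / 2 ≤ σ₀) (hσ₀1 : σ₀ < 1)
    (hZ : ∀ s : ℂ, σ₀ < s.re → riemannXi s ≠ 0) (hδ : 0 < δ) (hδ16 : δ ≤ 1 / 16) :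
    ∃ C : ℝ, 0 ≤ C ∧ ∀ y : ℝ, σ₀ - 1 / 2 + 4 * δ ≤ y → y ≤ 1 → ∀ u : ℝ,
      ‖thetaSym θ ((u : ℂ) + (y : ℂ) * I)‖ ≤ C * (1 + |u|) ^ (-(θ / 2)) := by
  obtain ⟨C₂, hC₂⟩ := norm_thetaSym_le_of_zeroFree hθ hσ₀ hσ₀1 hZ hδ hδ16
  have hθ0 : 0 < θ := by linarith
  -- compact part
  set S : Set ℂ := (Set.Icc (-8 : ℝ) 8) ×ℂ (Set.Icc (σ₀ - 1 / 2 + 4 * δ) 1) with hS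
  have hScpt : IsCompact S := isCompact_Icc.reProdIm isCompact_Icc
  have hSsub : S ⊆ {z : ℂ | σ₀ - 1 / 2 < z.im} := by
    intro z hz
    have h2 : z.im ∈ Set.Icc (σ₀ - 1 / 2 + 4 * δ) 1 := hz.2
    show σ₀ - 1 / 2 < z.im
    linarith [h2.1]
  have hcont : ContinuousOn (thetaSym θ) S :=
    ((differentiableOn_thetaSym_of_zeroFree θ hZ).continuousOn).mono hSsub
  obtain ⟨M₀, hM₀⟩ := hScpt.exists_bound_of_continuousOn hcont
  refine ⟨|C₂| * (2 : ℝ) ^ (θ / 2) + |M₀| * (9 : ℝ) ^ (θ / 2), by positivity, fun y hy1 hy2 u => ?_⟩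
  have hpos1 : 0 < 1 + |u| := by positivity
  have hA : 0 ≤ |C₂| * (2 : ℝ) ^ (θ / 2) * (1 + |u|) ^ (-(θ / 2)) := by positivity
  have hB : 0 ≤ |M₀| * (9 : ℝ) ^ (θ / 2) * (1 + |u|) ^ (-(θ / 2)) := by positivity
  rcases le_or_gt 8 |u| with hu | hu
  · -- |u| ≥ 8 : C2
    have h1 := hC₂ y hy1 hy2 u hu
    have hu0 : 0 < |u| := by linarith
    have h2 : |u| ^ (-(θ / 2)) ≤ (2 : ℝ) ^ (θ / 2) * (1 + |u|) ^ (-(θ / 2)) := by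
      have h21 : (2 * |u|) ^ (-(θ / 2)) ≤ (1 + |u|) ^ (-(θ / 2)) :=
        Real.rpow_le_rpow_of_nonpos hpos1 (by linarith) (by linarith)
      have h22 : (2 * |u|) ^ (-(θ / 2)) = (2 : ℝ) ^ (-(θ / 2)) * |u| ^ (-(θ / 2)) :=
        Real.mul_rpow (by norm_num) hu0.le
      have h23 : (2 : ℝ) ^ (θ / 2) * (2 : ℝ) ^ (-(θ / 2)) = 1 := by
        rw [← Real.rpow_add (by norm_num), add_neg_cancel, Real.rpow_zero]
      calc |u| ^ (-(θ / 2)) = (2 : ℝ) ^ (θ / 2) * ((2 : ℝ) ^ (-(θ / 2)) * |u| ^ (-(θ / 2))) := by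
            rw [← mul_assoc, h23, one_mul]
        _ = (2 : ℝ) ^ (θ / 2) * (2 * |u|) ^ (-(θ / 2)) := by rw [h22]
        _ ≤ (2 : ℝ) ^ (θ / 2) * (1 + |u|) ^ (-(θ / 2)) :=
            mul_le_mul_of_nonneg_left h21 (by positivity)
    calc ‖thetaSym θ ((u : ℂ) + (y : ℂ) * I)‖ ≤ C₂ * |u| ^ (-(θ / 2)) := h1
      _ ≤ |C₂| * |u| ^ (-(θ / 2)) := mul_le_mul_of_nonneg_right (le_abs_self _) (by positivity)
      _ ≤ |C₂| * ((2 : ℝ) ^ (θ / 2) * (1 + |u|) ^ (-(θ / 2))) :=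
          mul_le_mul_of_nonneg_left h2 (abs_nonneg _)
      _ = |C₂| * (2 : ℝ) ^ (θ / 2) * (1 + |u|) ^ (-(θ / 2)) := by ring
      _ ≤ (|C₂| * (2 : ℝ) ^ (θ / 2) + |M₀| * (9 : ℝ) ^ (θ / 2)) * (1 + |u|) ^ (-(θ / 2)) := by
          rw [add_mul]; linarith
  · -- |u| < 8 : compactness
    have hmem : (u : ℂ) + (y : ℂ) * I ∈ S := by
      rw [hS, Complex.mem_reProdIm]
      constructor
      · simp only [Complex.add_re, Complex.ofReal_re, Complex.mul_re, Complex.I_re, Complex.I_im,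
          Complex.ofReal_im, mul_zero, mul_one, sub_zero, add_zero]
        exact ⟨by linarith [neg_abs_le u], by linarith [le_abs_self u]⟩
      · simp only [Complex.add_im, Complex.ofReal_im, Complex.mul_im, Complex.I_re, Complex.I_im,
          Complex.ofReal_re, mul_zero, mul_one, zero_add, add_zero]
        exact ⟨hy1, hy2⟩
    have h1 := hM₀ _ hmem
    have h2 : (1 : ℝ) ≤ (9 : ℝ) ^ (θ / 2) * (1 + |u|) ^ (-(θ / 2)) := by
      have h21 : (9 : ℝ) ^ (-(θ / 2)) ≤ (1 + |u|) ^ (-(θ / 2)) :=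
        Real.rpow_le_rpow_of_nonpos hpos1 (by linarith) (by linarith)
      have h23 : (9 : ℝ) ^ (θ / 2) * (9 : ℝ) ^ (-(θ / 2)) = 1 := by
        rw [← Real.rpow_add (by norm_num), add_neg_cancel, Real.rpow_zero]
      calc (1 : ℝ) = (9 : ℝ) ^ (θ / 2) * (9 : ℝ) ^ (-(θ / 2)) := h23.symm
        _ ≤ (9 : ℝ) ^ (θ / 2) * (1 + |u|) ^ (-(θ / 2)) := mul_le_mul_of_nonneg_left h21 (by positivity)
    calc ‖thetaSym θ ((u : ℂ) + (y : ℂ) * I)‖ ≤ M₀ := h1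
      _ ≤ |M₀| * 1 := by rw [mul_one]; exact le_abs_self _
      _ ≤ |M₀| * ((9 : ℝ) ^ (θ / 2) * (1 + |u|) ^ (-(θ / 2))) :=
          mul_le_mul_of_nonneg_left h2 (abs_nonneg _)
      _ = |M₀| * (9 : ℝ) ^ (θ / 2) * (1 + |u|) ^ (-(θ / 2)) := by ring
      _ ≤ (|C₂| * (2 : ℝ) ^ (θ / 2) + |M₀| * (9 : ℝ) ^ (θ / 2)) * (1 + |u|) ^ (-(θ / 2)) := by
          rw [add_mul]; linarith

/-- RH-FREE complex analysis (K3's rectangle argument, generic form): a function holomorphic on `Im z > c₀`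
with a uniform integrable-power bound on the closed strip `a ≤ Im z ≤ b` (`c₀ < a ≤ b`) has the same inverse
Fourier–Laplace integral on the lines `Im z = a` and `Im z = b`. -/
theorem invFL_line_shift {Φ : ℂ → ℂ} {c₀ a b C r : ℝ} (hr : 1 < r) (hc₀a : c₀ < a) (hab : a ≤ b)
    (hΦd : DifferentiableOn ℂ Φ {z : ℂ | c₀ < z.im}) (hC0 : 0 ≤ C)
    (hbd : ∀ y : ℝ, a ≤ y → y ≤ b → ∀ u : ℝ, ‖Φ ((u : ℂ) + (y : ℂ) * I)‖ ≤ C * (1 + |u|) ^ (-r))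
    (x : ℝ) : invFL Φ a x = invFL Φ b x := by
  have hr0 : 0 < r := by linarith
  set F : ℂ → ℂ := fun z => Φ z * Complex.exp (-I * z * (x : ℂ)) with hF
  have hFd : DifferentiableOn ℂ F {z : ℂ | c₀ < z.im} := hΦd.mul (by fun_prop)
  set E : ℝ := Real.exp ((|a| + |b|) * |x|) with hE
  have hyx : ∀ y : ℝ, a ≤ y → y ≤ b → Real.exp (y * x) ≤ E := by
    intro y hy1 hy2
    rw [hE, Real.exp_le_exp]
    have h1 : y * x ≤ |y| * |x| := by rw [← abs_mul]; exact le_abs_self _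
    have h2 : |y| ≤ |a| + |b| := by
      rcases le_or_gt 0 y with hy | hy
      · rw [abs_of_nonneg hy]; linarith [le_abs_self b, abs_nonneg a]
      · rw [abs_of_neg hy]; linarith [neg_le_abs a, abs_nonneg b]
    have h3 : |y| * |x| ≤ (|a| + |b|) * |x| := mul_le_mul_of_nonneg_right h2 (abs_nonneg x)
    linarith
  have hbound : ∀ y : ℝ, a ≤ y → y ≤ b → ∀ u : ℝ,
      ‖F ((u : ℂ) + (y : ℂ) * I)‖ ≤ C * (1 + |u|) ^ (-r) * Real.exp (y * x) := by
    intro y hy1 hy2 u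
    simp only [hF, norm_mul, norm_exp_neg_I_mul]
    exact mul_le_mul_of_nonneg_right (hbd y hy1 hy2 u) (Real.exp_pos _).le
  -- integrability on the lines y ∈ [a, b]
  have hInt : ∀ y : ℝ, a ≤ y → y ≤ b → Integrable (fun u : ℝ => F ((u : ℂ) + (y : ℂ) * I)) := by
    intro y hy1 hy2
    have hmaj : Integrable (fun u : ℝ => C * Real.exp (y * x) * (1 + ‖u‖) ^ (-r)) :=
      (integrable_one_add_norm (E := ℝ) (μ := volume) (r := r) (by simp; linarith)).const_mul _
    have hcont : Continuous (fun u : ℝ => F ((u : ℂ) + (y : ℂ) * I)) := by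
      simp only [hF]
      exact (continuous_line_of_differentiableOn hΦd (by linarith)).mul (by fun_prop)
    refine hmaj.mono' hcont.aestronglyMeasurable (Eventually.of_forall fun u => ?_)
    have h := hbound y hy1 hy2 u
    rw [Real.norm_eq_abs]
    calc ‖F ((u : ℂ) + (y : ℂ) * I)‖ ≤ C * (1 + |u|) ^ (-r) * Real.exp (y * x) := h
      _ = C * Real.exp (y * x) * (1 + |u|) ^ (-r) := by ring
  -- Cauchy on the rectangle [-R, R] × [a, b]
  have hrect : ∀ R : ℝ, (∫ u in -R..R, F ((u : ℂ) + (a : ℂ) * I)) - (∫ u in -R..R, F ((u : ℂ) + (b : ℂ) * I))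
      + I • (∫ y in a..b, F ((R : ℂ) + (y : ℂ) * I)) - I • (∫ y in a..b, F (((-R : ℝ) : ℂ) + (y : ℂ) * I)) = 0 := by
    intro R
    have him1 : (((-R : ℝ) : ℂ) + (a : ℂ) * I).im = a := by simp
    have him2 : ((R : ℂ) + (b : ℂ) * I).im = b := by simp
    have hsub : (Set.uIcc (((-R : ℝ) : ℂ) + (a : ℂ) * I).re ((R : ℂ) + (b : ℂ) * I).re ×ℂ
        Set.uIcc (((-R : ℝ) : ℂ) + (a : ℂ) * I).im ((R : ℂ) + (b : ℂ) * I).im) ⊆ {z : ℂ | c₀ < z.im} := by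
      intro z hz
      have hz2 := hz.2
      rw [him1, him2, Set.mem_preimage, Set.uIcc_of_le hab] at hz2
      show c₀ < z.im
      linarith [hz2.1]
    have h := integral_boundary_rect_eq_zero_of_differentiableOn F (((-R : ℝ) : ℂ) + (a : ℂ) * I)
      ((R : ℂ) + (b : ℂ) * I) (hFd.mono hsub)
    simpa using h
  -- vertical sides → 0
  have hvert : ∀ s : ℝ → ℝ, Tendsto (fun R : ℝ => |s R|) atTop atTop →
      Tendsto (fun R : ℝ => ∫ y in a..b, F (((s R : ℝ) : ℂ) + (y : ℂ) * I)) atTop (𝓝 0) := by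
    intro s hs
    rw [tendsto_zero_iff_norm_tendsto_zero]
    have hmaj : ∀ R : ℝ, ‖∫ y in a..b, F (((s R : ℝ) : ℂ) + (y : ℂ) * I)‖ ≤
        C * E * |b - a| * (1 + |s R|) ^ (-r) := by
      intro R
      have h1 : ‖∫ y in a..b, F (((s R : ℝ) : ℂ) + (y : ℂ) * I)‖ ≤
          C * (1 + |s R|) ^ (-r) * E * |b - a| := by
        refine intervalIntegral.norm_integral_le_of_norm_le_const fun y hy => ?_
        rw [Set.uIoc_of_le hab] at hy
        have hy1 : a ≤ y := le_of_lt hy.1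
        calc ‖F (((s R : ℝ) : ℂ) + (y : ℂ) * I)‖ ≤ C * (1 + |s R|) ^ (-r) * Real.exp (y * x) :=
              hbound y hy1 hy.2 (s R)
          _ ≤ C * (1 + |s R|) ^ (-r) * E :=
              mul_le_mul_of_nonneg_left (hyx y hy1 hy.2) (by positivity)
      linarith [h1, show C * (1 + |s R|) ^ (-r) * E * |b - a| =
        C * E * |b - a| * (1 + |s R|) ^ (-r) from by ring]
    have hlim : Tendsto (fun R : ℝ => C * E * |b - a| * (1 + |s R|) ^ (-r)) atTop (𝓝 0) := by
      have h1 : Tendsto (fun R : ℝ => 1 + |s R|) atTop atTop := tendsto_atTop_add_const_left _ _ hs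
      have h2 := (tendsto_rpow_neg_atTop hr0).comp h1
      simpa using h2.const_mul (C * E * |b - a|)
    exact squeeze_zero (fun R => norm_nonneg _) hmaj hlim
  have hvR := hvert (fun R => R) (by simpa using tendsto_abs_atTop_atTop)
  have hvL := hvert (fun R => -R) (by simp only [abs_neg]; exact tendsto_abs_atTop_atTop)
  -- horizontal sides → line integrals
  have hha := intervalIntegral_tendsto_integral (hInt a le_rfl hab) tendsto_neg_atTop_atBot tendsto_id
  have hhb := intervalIntegral_tendsto_integral (hInt b hab le_rfl) tendsto_neg_atTop_atBot tendsto_id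
  have hcomb : Tendsto (fun R : ℝ => (∫ u in -R..R, F ((u : ℂ) + (a : ℂ) * I)) - (∫ u in -R..R, F ((u : ℂ) + (b : ℂ) * I))
      + I • (∫ y in a..b, F ((R : ℂ) + (y : ℂ) * I)) - I • (∫ y in a..b, F (((-R : ℝ) : ℂ) + (y : ℂ) * I)))
      atTop (𝓝 ((∫ u : ℝ, F ((u : ℂ) + (a : ℂ) * I)) - (∫ u : ℝ, F ((u : ℂ) + (b : ℂ) * I)) + I • 0 - I • 0)) :=
    ((hha.sub hhb).add (hvR.const_smul I)).sub (hvL.const_smul I)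
  have hzero : Tendsto (fun R : ℝ => (∫ u in -R..R, F ((u : ℂ) + (a : ℂ) * I)) - (∫ u in -R..R, F ((u : ℂ) + (b : ℂ) * I))
      + I • (∫ y in a..b, F ((R : ℂ) + (y : ℂ) * I)) - I • (∫ y in a..b, F (((-R : ℝ) : ℂ) + (y : ℂ) * I)))
      atTop (𝓝 0) := by
    have : (fun R : ℝ => (∫ u in -R..R, F ((u : ℂ) + (a : ℂ) * I)) - (∫ u in -R..R, F ((u : ℂ) + (b : ℂ) * I))
      + I • (∫ y in a..b, F ((R : ℂ) + (y : ℂ) * I)) - I • (∫ y in a..b, F (((-R : ℝ) : ℂ) + (y : ℂ) * I))) =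
        fun _ => 0 := funext hrect
    rw [this]; exact tendsto_const_nhds
  have heq := tendsto_nhds_unique hcomb hzero
  simp only [smul_zero, add_zero, sub_zero] at heq
  unfold invFL
  congr 1
  have e1 : (∫ u : ℝ, Φ ((u : ℂ) + (b : ℂ) * I) * Complex.exp (-I * ((u : ℂ) + (b : ℂ) * I) * (x : ℂ))) =
      ∫ u : ℝ, F ((u : ℂ) + (b : ℂ) * I) := rfl
  have e2 : (∫ u : ℝ, Φ ((u : ℂ) + (a : ℂ) * I) * Complex.exp (-I * ((u : ℂ) + (a : ℂ) * I) * (x : ℂ))) =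
      ∫ u : ℝ, F ((u : ℂ) + (a : ℂ) * I) := rfl
  rw [e1, e2]
  exact sub_eq_zero.1 heq

/-- RH-FREE implication: KERNEL GROWTH in a zero-free half-plane. If `ξ ≠ 0` on `Re s > σ₀` (`1/2 ≤ σ₀ < 1`),
then for `θ > 10`, `0 < δ ≤ 1/16`: `|K_θ(x)| ≤ D e^{(σ₀ − 1/2 + 4δ) x}` for all `x`. -/
theorem abs_limKernel_le_of_zeroFree {θ σ₀ δ : ℝ} (hθ : 10 < θ) (hσ₀ : 1 / 2 ≤ σ₀) (hσ₀1 : σ₀ < 1)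
    (hZ : ∀ s : ℂ, σ₀ < s.re → riemannXi s ≠ 0) (hδ : 0 < δ) (hδ16 : δ ≤ 1 / 16) :
    ∃ D : ℝ, ∀ x : ℝ, |SuzukiDoor.limKernel θ x| ≤ D * Real.exp ((σ₀ - 1 / 2 + 4 * δ) * x) := by
  obtain ⟨C, hC0, hC⟩ := norm_thetaSym_le_uniform hθ hσ₀ hσ₀1 hZ hδ hδ16
  set y₀ : ℝ := σ₀ - 1 / 2 + 4 * δ with hy₀
  have hy₀1 : y₀ ≤ 1 := by rw [hy₀]; linarith
  have hc₀ : σ₀ - 1 / 2 < y₀ := by rw [hy₀]; linarith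
  have hθ2 : 1 < θ / 2 := by linarith
  have hΦd := differentiableOn_thetaSym_of_zeroFree θ hZ
  -- integrable majorant on the line y₀
  have hmaj : Integrable (fun u : ℝ => C * (1 + ‖u‖) ^ (-(θ / 2))) :=
    (integrable_one_add_norm (E := ℝ) (μ := volume) (r := θ / 2) (by simp; linarith)).const_mul _
  have hcont : Continuous (fun u : ℝ => thetaSym θ ((u : ℂ) + (y₀ : ℂ) * I)) :=
    continuous_line_of_differentiableOn hΦd hc₀
  have hIntN : Integrable (fun u : ℝ => ‖thetaSym θ ((u : ℂ) + (y₀ : ℂ) * I)‖) := by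
    refine hmaj.mono' hcont.norm.aestronglyMeasurable (Eventually.of_forall fun u => ?_)
    rw [Real.norm_eq_abs, abs_norm]
    exact hC y₀ le_rfl hy₀1 u
  refine ⟨1 / (2 * Real.pi) * ∫ u : ℝ, C * (1 + ‖u‖) ^ (-(θ / 2)), fun x => ?_⟩
  have hK : SuzukiDoor.limKernel θ x = (invFL (thetaSym θ) 1 x).re := rfl
  rw [hK, ← invFL_line_shift hθ2 hc₀ hy₀1 hΦd hC0 hC x]
  have h1 := norm_invFL_le (thetaSym θ) y₀ x
  have h2 : (∫ u : ℝ, ‖thetaSym θ ((u : ℂ) + (y₀ : ℂ) * I)‖) ≤ ∫ u : ℝ, C * (1 + ‖u‖) ^ (-(θ / 2)) :=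
    integral_mono hIntN hmaj fun u => by simpa [Real.norm_eq_abs] using hC y₀ le_rfl hy₀1 u
  have hπ : 0 ≤ 1 / (2 * Real.pi) * Real.exp (y₀ * x) := by positivity
  calc |(invFL (thetaSym θ) y₀ x).re| ≤ ‖invFL (thetaSym θ) y₀ x‖ := Complex.abs_re_le_norm _
    _ ≤ 1 / (2 * Real.pi) * Real.exp (y₀ * x) * ∫ u : ℝ, ‖thetaSym θ ((u : ℂ) + (y₀ : ℂ) * I)‖ := h1
    _ ≤ 1 / (2 * Real.pi) * Real.exp (y₀ * x) * ∫ u : ℝ, C * (1 + ‖u‖) ^ (-(θ / 2)) :=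
        mul_le_mul_of_nonneg_left h2 hπ
    _ = (1 / (2 * Real.pi) * ∫ u : ℝ, C * (1 + ‖u‖) ^ (-(θ / 2))) * Real.exp (y₀ * x) := by ring

/-! ### The crux `WitnessOfZeroFree` (RH-FREE implication), PROVED -/

/-- **Crux `WitnessOfZeroFree` of the v5 route «SuzukiWeightedDoor» — PROVED (RH-FREE implication).**
If `ξ ≠ 0` on `Re s > σ₀` with `1/2 ≤ σ₀ < 1/2 + η`, then `e^{−ηx} W_θ(x) ∈ L²(ℝ)` for every `θ > 10`
(Titchmarsh §14.2 three-circles + Stirling + Cauchy line shift + the generic weighted-window lemma).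
Verbatim the route item's signature. Nothing here bears on the truth of RH. -/
theorem witnessOfZeroFree : ∀ θ : ℝ, 10 < θ → ∀ η σ₀ : ℝ, 1 / 2 ≤ σ₀ → σ₀ < 1 / 2 + η →
    (∀ s : ℂ, σ₀ < s.re → Literature.NumberTheory.LFunctions.riemannXi s ≠ 0) →
      MeasureTheory.MemLp (fun x : ℝ => Real.exp (-η * x) *
        Summit.RiemannHypothesis.RiemannHypothesis.Theorems.SuzukiDoor.limWindowAvg θ x) 2 MeasureTheory.volume := by
  intro θ hθ η σ₀ hσ₀ hση hZ
  have hθ1 : 1 < θ := by linarith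
  have hKc : Continuous (SuzukiDoor.limKernel θ) := Suzuki2020_thm12_continuous hθ1
  have hK0 : ∀ x : ℝ, x < 0 → SuzukiDoor.limKernel θ x = 0 := fun x hx => Suzuki2020_thm12_Kiii hθ1 hx
  show MemLp (fun x : ℝ => Real.exp (-η * x) * ∫ y in Set.Ioo (0 : ℝ) 1, SuzukiDoor.limKernel θ (x + y)) 2 volume
  rcases lt_or_ge (1 / 2 : ℝ) η with hη | hη
  · -- η > 1/2: the unconditional rung ([Su20] (K-iii) growth bound on lines b > 1/2)
    obtain ⟨D, -, hD⟩ := abs_limKernel_le hθ1 (b := (1 / 2 + η) / 2) (by linarith)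
    exact SuzukiWeightedDoorRung.memLp_weightedWindow hKc hK0 (b := (1 / 2 + η) / 2) (η := η)
      (by linarith) (by linarith) (fun x _ => hD x)
  · -- η ≤ 1/2: σ₀ < 1; use the zero-free growth bound with 4δ < 1/2 + η − σ₀
    have hσ₀1 : σ₀ < 1 := by linarith
    set δ : ℝ := min (1 / 16) ((1 / 2 + η - σ₀) / 8) with hδdef
    have hδ : 0 < δ := by rw [hδdef]; exact lt_min (by norm_num) (by linarith)
    have hδ16 : δ ≤ 1 / 16 := min_le_left _ _
    have hδ8 : δ ≤ (1 / 2 + η - σ₀) / 8 := min_le_right _ _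
    obtain ⟨D, hD⟩ := abs_limKernel_le_of_zeroFree hθ hσ₀ hσ₀1 hZ hδ hδ16
    exact SuzukiWeightedDoorRung.memLp_weightedWindow hKc hK0 (b := σ₀ - 1 / 2 + 4 * δ) (η := η)
      (by linarith) (by linarith) (fun x _ => hD x)

end Summit.RiemannHypothesis.RiemannHypothesis.Theorems.SuzukiWeightedDoorConverse

end
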